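import Literature.MathematicalPhysics.QuantumFieldTheory.QCDPhaseQuenchedReweighting
import Summits.QuantumFields.QCD.Theorems.GluonicCompletion.Negative.Reweighting

/-!
# Crux `GluonicCompletion` (stmt-QuantumFields-9152), line `finite-sign-budget-at-the-scheme-volume` —
# the sign-free slice of stub `stub_signDecorrelation`

The sign–observable covariance `Cov₊(W, R) = ⟨W R⟩₊ − ⟨W⟩₊⟨R⟩₊` of the line (with `⟨·⟩₊ = qcdPhaseQuenchedExpect`
the `|det D|`-reweighted Wilson expectation and `W = qcdDetPhase` the determinant sign) vanishes IDENTICALLY on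
the isospin-symmetric two-flavour locus `N_f = 2`, `m_u = m_d`: there `det D = (det D_W)² ≥ 0` configuration-wise
(`Negative.det_re_nonneg_two_degenerate`), so `|det D| • (W R) = |det D| • R` pointwise (where `det D = 0` the weight
kills both sides; elsewhere `W = 1`), hence `⟨W R⟩₊ = ⟨R⟩₊` and `⟨W⟩₊ = ⟨1⟩₊`, and the covariance is `0` whether or
not the phase-quenched denominator vanishes (junk `0⁻¹ = 0` makes every `⟨·⟩₊` zero). No a.e. non-vanishing of
`det D`, no sign coherence and no convergence hypothesis is needed.

* `smul_qcdDetPhase_mul_two_degenerate` — the pointwise identity `|det D| • (W r) = |det D| • r`.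
* `cov_qcdDetPhase_eq_zero_two_degenerate` — `⟨W R⟩₊ − ⟨W⟩₊⟨R⟩₊ = 0` for every complex observable `R`.
* `signDecorrelation_two_degenerate` (registered sub-goal, via `signDecorrelation_two_degenerate_aux`) — the conclusion of `stub_signDecorrelation` for `N_f = 2`, `m 0 = m 1`,
  for every regularisation, renormalisations, subsequence and species string (the covariance sequence is the
  constant `0`).
-/

noncomputable section

namespace Summit.QuantumFields.QCD.Theorems.FiniteSignBudgetAtTheSchemeVolume

open scoped BigOperators Topology ENNReal SchwartzMap
open MeasureTheory Filter
open Literature.MathematicalPhysics.QuantumFieldTheory Literature.MathematicalPhysics.QuantumLattice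
  Literature.Probability.LatticeModels Literature.MathematicalPhysics.AQFT

variable {S : ℕ} [NeZero S]

/-- On the degenerate two-flavour locus the reweighting factor is invisible under the phase-quenched weight:
`|det D(U)| • (W(U) r) = |det D(U)| • r` for every `U` and `r` (`det D = (det D_W)² ≥ 0`, so `W = 1` wherever
`det D ≠ 0`, and both sides vanish where `det D = 0`). [folklore] -/
theorem smul_qcdDetPhase_mul_two_degenerate (U : GaugeConfig 4 S SU3) (mq : Fin 2 → ℝ) (h : mq 0 = mq 1)
    (r : ℂ) : ‖(diracMatrix U mq).det‖ • (qcdDetPhase U mq * r) = ‖(diracMatrix U mq).det‖ • r := by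
  by_cases h0 : (diracMatrix U mq).det = 0
  · simp [h0]
  · have hre : 0 < ((diracMatrix U mq).det).re := by
      refine lt_of_le_of_ne (GluonicCompletion.Negative.det_re_nonneg_two_degenerate U mq h) fun h0' => h0 ?_
      rw [det_diracMatrix_eq_ofReal_re U mq, ← h0', Complex.ofReal_zero]
    rw [qcdDetPhase_eq_sign, sign_pos hre, SignType.coe_one, Complex.ofReal_one, one_mul]

/-- **No sign problem, no covariance.** For `N_f = 2` with degenerate bare masses `m_u = m_d`, on every torus and
at every coupling, `⟨W R⟩₊ − ⟨W⟩₊ ⟨R⟩₊ = 0` for every complex gauge functional `R` (in particular for every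
Berezin ratio): `⟨W R⟩₊ = ⟨R⟩₊` and `⟨W⟩₊ = ⟨1⟩₊ ∈ {0, 1}` according as the phase-quenched denominator vanishes
or not, and in the junk case `⟨R⟩₊ = 0` as well. [folklore] -/
theorem cov_qcdDetPhase_eq_zero_two_degenerate (β : ℝ) (mq : Fin 2 → ℝ) (h : mq 0 = mq 1)
    (R : GaugeConfig 4 S SU3 → ℂ) :
    qcdPhaseQuenchedExpect β S mq (fun U => qcdDetPhase U mq * R U) -
        qcdPhaseQuenchedExpect β S mq (fun U => qcdDetPhase U mq) * qcdPhaseQuenchedExpect β S mq R = 0 := by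
  have h1 : qcdPhaseQuenchedExpect β S mq (fun U => qcdDetPhase U mq * R U) = qcdPhaseQuenchedExpect β S mq R := by
    simp only [qcdPhaseQuenchedExpect_def, smul_qcdDetPhase_mul_two_degenerate _ mq h]
  have h2 : qcdPhaseQuenchedExpect β S mq (fun U => qcdDetPhase U mq) =
      qcdPhaseQuenchedExpect β S mq (fun _ => (1 : ℂ)) := by
    simp only [qcdPhaseQuenchedExpect_def]
    congr 1
    refine integral_congr_ae (Eventually.of_forall fun U => ?_)
    have := smul_qcdDetPhase_mul_two_degenerate U mq h 1
    rwa [mul_one] at this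
  rw [h1, h2]
  by_cases hZ : ∫ U, ‖(diracMatrix U mq).det‖ ∂(wilsonMeasure (d := 4) (L := S) (fundamentalRep (Fin 3)) β) = 0
  · simp [qcdPhaseQuenchedExpect_def, hZ]
  · rw [qcdPhaseQuenchedExpect_const β mq hZ, one_mul, sub_self]

/-- **The sign-free slice of `stub_signDecorrelation`.** For `N_f = 2` and a mass tuple with `m 0 = m 1`, along
ANY regularisation `reg`, renormalisations `(z, shift)`, reindexing `φ` and species string `σ` on test functions
`f`, the phase-quenched covariance between the determinant sign and the Berezin ratio of the smeared product is
the constant sequence `0`, hence tends to `0`: the bare masses `m_crit(k) + a_k m_f / Z_m(k)` of the two flavours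
coincide at every step, so `cov_qcdDetPhase_eq_zero_two_degenerate` applies torus by torus. (The hypothesis body
`H(reg)`, strict monotonicity of `φ` and the convergence of the phase-quenched Schwinger functions demanded by the
stub are not needed on this locus.) [folklore] -/
private theorem signDecorrelation_two_degenerate_aux (reg : QCDRegularisation 2) (m : Fin 2 → ℝ) (hm : m 0 = m 1)
    (z shift : QCDField 2 → ℕ → ℝ) (φ : ℕ → ℕ) (n : ℕ) (σ : Fin n → QCDField 2)
    (f : Fin n → 𝓢(EuclideanSpace ℝ (Fin 4), ℝ)) :
    Tendsto (fun k : ℕ =>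
      (qcdPhaseQuenchedExpect ((reg.scheme m z shift).β (φ k)) ((reg.scheme m z shift).side (φ k)) (fun fl => (reg.scheme m z shift).mq fl (φ k)) (fun U => qcdDetPhase U (fun fl => (reg.scheme m z shift).mq fl (φ k)) * (fermiIntegral ((List.ofFn fun i => smearedInsertion (reg.scheme m z shift) (φ k) U (σ i) (f i)).prod * fermiBoltzmann U fun fl => (reg.scheme m z shift).mq fl (φ k)) / fermiIntegral (fermiBoltzmann U fun fl => (reg.scheme m z shift).mq fl (φ k)))) -
        qcdPhaseQuenchedExpect ((reg.scheme m z shift).β (φ k)) ((reg.scheme m z shift).side (φ k)) (fun fl => (reg.scheme m z shift).mq fl (φ k)) (fun U => qcdDetPhase U (fun fl => (reg.scheme m z shift).mq fl (φ k))) *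
          qcdPhaseQuenchedExpect ((reg.scheme m z shift).β (φ k)) ((reg.scheme m z shift).side (φ k)) (fun fl => (reg.scheme m z shift).mq fl (φ k)) (fun U => (fermiIntegral ((List.ofFn fun i => smearedInsertion (reg.scheme m z shift) (φ k) U (σ i) (f i)).prod * fermiBoltzmann U fun fl => (reg.scheme m z shift).mq fl (φ k)) / fermiIntegral (fermiBoltzmann U fun fl => (reg.scheme m z shift).mq fl (φ k)))))) atTop (𝓝 0) := by
  refine tendsto_const_nhds.congr fun k => (cov_qcdDetPhase_eq_zero_two_degenerate _ _ ?_ _).symm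
  simp only [QCDRegularisation.scheme_mq, hm]

/-- **Registered sub-goal `signDecorrelation_two_degenerate`** (verbatim): the conclusion of `stub_signDecorrelation` on the
isospin-symmetric two-flavour locus `N_f = 2`, `m 0 = m 1`, for every regularisation, renormalisations, subsequence and
species string — the covariance sequence is the constant `0`. [folklore] -/
theorem signDecorrelation_two_degenerate :
    open scoped SchwartzMap in open MeasureTheory Filter Topology Literature.MathematicalPhysics.QuantumFieldTheory Literature.MathematicalPhysics.QuantumLattice Literature.Probability.LatticeModels Literature.MathematicalPhysics.AQFT in ∀ (reg : QCDRegularisation 2) (m : Fin 2 → ℝ), m 0 = m 1 → ∀ (z shift : QCDField 2 → ℕ → ℝ) (φ : ℕ → ℕ) (n : ℕ) (σ : Fin n → QCDField 2) (f : Fin n → SchwartzMap (EuclideanSpace ℝ (Fin 4)) ℝ), Tendsto (fun k : ℕ => (qcdPhaseQuenchedExpect ((reg.scheme m z shift).β (φ k)) ((reg.scheme m z shift).side (φ k)) (fun fl => (reg.scheme m z shift).mq fl (φ k)) (fun U => qcdDetPhase U (fun fl => (reg.scheme m z shift).mq fl (φ k)) * (fermiIntegral ((List.ofFn fun i => smearedInsertion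 (reg.scheme m z shift) (φ k) U (σ i) (f i)).prod * fermiBoltzmann U fun fl => (reg.scheme m z shift).mq fl (φ k)) / fermiIntegral (fermiBoltzmann U fun fl => (reg.scheme m z shift).mq fl (φ k)))) - qcdPhaseQuenchedExpect ((reg.scheme m z shift).β (φ k)) ((reg.scheme m z shift).side (φ k)) (fun fl => (reg.scheme m z shift).mq fl (φ k)) (fun U => qcdDetPhase U (fun fl => (reg.scheme m z shift).mq fl (φ k))) * qcdPhaseQuenchedExpect ((reg.scheme m z shift).β (φ k)) ((reg.scheme m z shift).side (φ k)) (fun fl => (reg.scheme m z shift).mq fl (φ k)) (fun U => (fermiIntegral ((List.ofFn fun i => smearedInsertion (reg.scheme m z shift) (φ k) U (σ i) (f i)).prod * fermiBoltzmann U fun fl => (reg.scheme m z shift).mq fl (φ k)) / fermiIntegral (fermiBoltzmann U fun fl => (reg.scheme m z shift).mq fl (φ k)))))) atTop (nhds 0) :=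
  fun reg m hm z shift φ n σ f => signDecorrelation_two_degenerate_aux reg m hm z shift φ n σ f

end Summit.QuantumFields.QCD.Theorems.FiniteSignBudgetAtTheSchemeVolume

end
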